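import Summits.Ventures.LatticeQCDFlow.Exactness.IMHCouplingTotalVariationDiagnostic
import Summits.Ventures.LatticeQCDFlow.Exactness.IMHCommonRandomNumbersMeetingTimeAnyCoupling
import Summits.Ventures.LatticeQCDFlow.Exactness.IMHModeRenewal
import Summits.Ventures.LatticeQCDFlow.Exactness.IMHWarmStartSandwich
import HarnessLib

/-!
# The coupling diagnostic is SHARP: for the cold-started exact sampler coupled one update apart by common random numbers,
# `Σ_{n≥b} P(X_n ≠ X′_n) = r^b` EXACTLY — and `r^b` IS the total-variation distance of the cold run from the target at time `b`

HONEST FRAMING: exact (Metropolis-corrected) sampling algorithms for lattice gauge theory;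
figures of merit are autocorrelation/cost numbers at stated couplings and volumes; no
continuum-physics claim.

Venture `LatticeQCDFlow` (cell pub-lqcd), topic `Exactness`; FANOUT row 30 (lean-1, GEN-39).  NEW WORK of the cell; sequel to
`Exactness/IMHCouplingTotalVariationDiagnostic` (under the lag-one coupling `|π(S) − P(Y_b ∈ S)| ≤ Σ_{n≥0} P(X_{b+n} ≠ X′_{b+n})` for every
measurable `S`), GEN-32's `IMHModeRenewal` (the cold run's law `δ_{x₀}K^b = (1 − r^b)π + r^b δ_{x₀}`, total variation `r^b(1 − π{x₀})`) and this
generation's meeting-time laws (`…MeetingTimeTwoStarts`: from an ordered start the pair separates with probability exactly `(1 − A(heavier))ⁿ`).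
The COLD LAG-ONE COUPLING is `ν̂ = K(x₀, ·) ⊗ δ_{x₀}` (production run `Y` started AT THE MODE `x₀` of the normalised weight `w`, `W = w(x₀)`,
`r = 1 − 1/W`; the leading run one update ahead); `MeasurableSingletonClass Ω`, `MeasurableEq Ω`:

* §1 **`coldLag_eq_mixture`** — `ν̂ = (1/W)·(π ⊗ δ_{x₀}) + r·δ_{(x₀,x₀)}` [from `indepMH_mode_eq`]; **`coldLag_lagOne`** — `ν̂∘fst⁻¹ = (ν̂∘snd⁻¹)K`.
* §2 **`iterate_bind_crnPair_stationaryCold_offDiagonal_eq`** — STATIONARY VERSUS COLD (`π ⊗ δ_{x₀}`, no atom at `x₀`): `P(X_n ≠ X′_n) = rⁿ` EXACTLY;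
  **`iterate_bind_crnPair_coldLag_offDiagonal_eq`** — the cold lag-one coupling: `P(X_n ≠ X′_n) = rⁿ/W` EXACTLY, every `n`;
  **`crn_coldLag_hasSum_offDiagonal`** — `Σ_{n≥0} P(X_{b+n} ≠ X′_{b+n}) = r^b` EXACTLY (`(1/W)·Σ_{n≥b} rⁿ = r^b`, as `1 − r = 1/W`).
* §3 **`crn_coldSnd_measureReal_snd_eq`** — a pair chain whose second coordinate starts at `x₀` carries the cold run (`P(Y_b ∈ S) = δ_{x₀}K^b(S)`);
  **`crn_coldLag_diagnostic_attained`** — on `S = {x₀}ᶜ`: `|π(S) − P(Y_b ∈ S)| = r^b = Σ_{n≥0} P(X_{b+n} ≠ X′_{b+n})`: THE INEQUALITY OF THE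
  DIAGNOSTIC IS AN EQUALITY — the coupling-based bound on the remaining bias cannot be improved for the exact sampler started at the mode;
  **`crn_coldLag_diagnostic_eq_totalVariation`** — for every measurable `S`, `|π(S) − P(Y_b ∈ S)| ≤ r^b` with equality at `{x₀}ᶜ`, both sides
  being what the coupled runs report.
* §4 EVERY LAG `L ≥ 1` (cold lag-`L` coupling `ν̂_L = K^L(x₀, ·) ⊗ δ_{x₀} = (1 − r^L)(π ⊗ δ_{x₀}) + r^L δ_{(x₀,x₀)}`, **`coldLagL_eq_mixture`**):
  **`iterate_bind_crnPair_coldLagL_offDiagonal_eq`** — `P(X_n ≠ X′_n) = (1 − r^L)·rⁿ`; **`crn_coldLagL_hasSum_offDiagonal`** —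
  `Σ_{j≥0} P(X_{k+jL} ≠ X′_{k+jL}) = r^k` EXACTLY; **`crn_coldLagL_diagnostic_eq_totalVariation`** — the lag-`L` diagnostic of
  `…TotalVariationDiagnostic` §4 is attained on `{x₀}ᶜ`: for every lag the coupled runs report exactly the total variation `r^k`.
Reading (gauge files): for the exact gauge sampler started from the reference configuration, the expected number of residual disagreements of the
coupled pair is not merely an upper bound on the remaining systematic error of every bounded measurement — it is its exact worst case.
NOT CLAIMED: proposals with an atom at `x₀` (finite `G`: the diagnostic then exceeds the total variation `r^b(1 − π{x₀})` — not computed here);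
warm starts (the diagnostic is then only an upper bound); any value of `A`.  No `sorry`, no new definitions, nothing cited as a fact.
-/

noncomputable section

namespace Summit.Ventures.LatticeQCDFlow.Exactness

open MeasureTheory ProbabilityTheory Function Finset Filter
open scoped ENNReal unitInterval Topology
open Summit.Ventures.LatticeQCDFlow.Scoring

variable {Ω : Type*} [MeasurableSpace Ω] {q : Measure Ω} [IsProbabilityMeasure q] {w : Ω → ℝ}

/-! ## §1 The cold lag-one coupling `ν̂ = K(x₀, ·) ⊗ δ_{x₀}` -/

/-- **`K(x₀, ·) ⊗ δ_{x₀} = (1/W)·(π ⊗ δ_{x₀}) + r·δ_{(x₀,x₀)}`** (`w` a `Fact`-measurable normalised weight, positive, maximal at `x₀`). [ours] -/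
theorem coldLag_eq_mixture [Fact (Measurable w)] (hw0 : ∀ y, 0 < w y) {x₀ : Ω} (hmax : ∀ y, w y ≤ w x₀)
    [IsProbabilityMeasure (q.withDensity fun y => ENNReal.ofReal (w y))] :
    (indepMH q w x₀).prod (Measure.dirac x₀) =
      ENNReal.ofReal (w x₀)⁻¹ • ((q.withDensity fun y => ENNReal.ofReal (w y)).prod (Measure.dirac x₀)) +
        ENNReal.ofReal (1 - (w x₀)⁻¹) • Measure.dirac (x₀, x₀) := by
  have hw : Measurable w := Fact.out
  rw [Measure.prod_dirac, indepMH_mode_eq hw hw0 hmax, Measure.map_add _ _ measurable_prodMk_right, Measure.map_smul, Measure.map_smul,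
    ← Measure.prod_dirac, Measure.map_dirac' measurable_prodMk_right]

/-- The marginals of `ν̂`: `ν̂∘fst⁻¹ = K(x₀, ·)`, `ν̂∘snd⁻¹ = δ_{x₀}`. [ours, bookkeeping] -/
theorem coldLag_map_fst_snd [Fact (Measurable w)] (x₀ : Ω) :
    ((indepMH q w x₀).prod (Measure.dirac x₀)).map Prod.fst = indepMH q w x₀ ∧
      ((indepMH q w x₀).prod (Measure.dirac x₀)).map Prod.snd = Measure.dirac x₀ := by
  constructor
  · rw [Measure.map_fst_prod, measure_univ, one_smul]
  · rw [Measure.map_snd_prod, measure_univ, one_smul]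

/-- **THE LAG-ONE CONDITION** `ν̂∘fst⁻¹ = (ν̂∘snd⁻¹)K` for the cold coupling. [ours, bookkeeping] -/
theorem coldLag_lagOne [Fact (Measurable w)] (x₀ : Ω) :
    ((indepMH q w x₀).prod (Measure.dirac x₀)).map Prod.fst =
      (((indepMH q w x₀).prod (Measure.dirac x₀)).map Prod.snd).bind (indepMH q w) := by
  obtain ⟨h1, h2⟩ := coldLag_map_fst_snd (q := q) (w := w) x₀
  rw [h1, h2, Measure.dirac_bind (Kernel.measurable _)]

/-! ## §2 The disagreement probabilities of the cold coupling, exactly -/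

/-- **STATIONARY VERSUS COLD: `P(X_n ≠ X′_n) = rⁿ` EXACTLY** for the pair chain from `π ⊗ δ_{x₀}` — leading run in equilibrium, production
run at the mode (`MeasurableSingletonClass Ω`, `MeasurableEq Ω`; no atom at `x₀`): the heavier configuration is the mode, whose acceptance
probability is `1/W`. [ours] -/
theorem iterate_bind_crnPair_stationaryCold_offDiagonal_eq [MeasurableSingletonClass Ω] [MeasurableEq Ω] (hw : Measurable w)
    (hw0 : ∀ y, 0 < w y) {x₀ : Ω} (hmax : ∀ y, w y ≤ w x₀) (hqx : q {x₀} = 0)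
    [IsProbabilityMeasure (q.withDensity fun y => ENNReal.ofReal (w y))] (Khat : Kernel (Ω × Ω) (Ω × Ω)) [IsMarkovKernel Khat]
    (hK : ∀ z : Ω × Ω, Khat z = (q.prod (volume : Measure unitInterval)).map (fun p : Ω × unitInterval =>
      ((if (p.2 : ℝ) * w z.1 ≤ w p.1 then p.1 else z.1), (if (p.2 : ℝ) * w z.2 ≤ w p.1 then p.1 else z.2)))) (n : ℕ) :
    ((fun m : Measure (Ω × Ω) => m.bind Khat)^[n] ((q.withDensity fun y => ENNReal.ofReal (w y)).prod (Measure.dirac x₀))).real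
        (Set.diagonal Ω)ᶜ = (1 - (w x₀)⁻¹) ^ n := by
  have hWinv0 : 0 ≤ (w x₀)⁻¹ := inv_nonneg.2 (hw0 x₀).le
  set π : Measure Ω := q.withDensity fun y => ENNReal.ofReal (w y) with hπ
  have hord : (π.prod (Measure.dirac x₀)) {p : Ω × Ω | w p.1 ≤ w p.2} = 1 := by
    refine le_antisymm prob_le_one ?_
    have h1 : (π.prod (Measure.dirac x₀)) (Set.univ ×ˢ ({x₀} : Set Ω)) = 1 := by
      rw [Measure.prod_prod, measure_univ, Measure.dirac_apply_of_mem (Set.mem_singleton x₀), one_mul]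
    rw [← h1]
    refine measure_mono fun p hp => ?_
    simp only [Set.mem_prod, Set.mem_univ, Set.mem_singleton_iff, true_and] at hp
    show w p.1 ≤ w p.2
    rw [hp]; exact hmax _
  have h := iterate_bind_crnPair_offDiagonal_eq_holding' hw hw0 hqx Khat hK n (π.prod (Measure.dirac x₀))
    (by rw [Measure.map_snd_prod, measure_univ, one_smul]) hord
    (by rw [Measure.map_fst_prod, measure_univ, one_smul]; exact withDensity_singleton_eq_zero hqx)
  rw [h, imhAcceptMass_mode_eq hw0 hmax, ENNReal.toReal_ofReal hWinv0]

/-- **`P(X_n ≠ X′_n) = rⁿ/W` EXACTLY from the cold lag-one coupling** (`MeasurableSingletonClass Ω`, `MeasurableEq Ω`; the proposal has no atom at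
`x₀`): the `r`-part of `ν̂` sits on the diagonal and never separates; the `(1/W)`-part starts from `π ⊗ δ_{x₀}` — the heavier configuration is
the mode, acceptance probability `1/W` — and separates with probability exactly `rⁿ`. [ours] -/
theorem iterate_bind_crnPair_coldLag_offDiagonal_eq [MeasurableSingletonClass Ω] [MeasurableEq Ω] [Fact (Measurable w)] (hw0 : ∀ y, 0 < w y)
    {x₀ : Ω} (hmax : ∀ y, w y ≤ w x₀) (hqx : q {x₀} = 0) [IsProbabilityMeasure (q.withDensity fun y => ENNReal.ofReal (w y))]
    (Khat : Kernel (Ω × Ω) (Ω × Ω)) [IsMarkovKernel Khat]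
    (hK : ∀ z : Ω × Ω, Khat z = (q.prod (volume : Measure unitInterval)).map (fun p : Ω × unitInterval =>
      ((if (p.2 : ℝ) * w z.1 ≤ w p.1 then p.1 else z.1), (if (p.2 : ℝ) * w z.2 ≤ w p.1 then p.1 else z.2)))) (n : ℕ) :
    ((fun m : Measure (Ω × Ω) => m.bind Khat)^[n] ((indepMH q w x₀).prod (Measure.dirac x₀))).real (Set.diagonal Ω)ᶜ =
      (w x₀)⁻¹ * (1 - (w x₀)⁻¹) ^ n := by
  have hw : Measurable w := Fact.out
  have hW : 1 ≤ w x₀ := one_le_of_mode (q := q) hmax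
  have hWinv0 : 0 ≤ (w x₀)⁻¹ := inv_nonneg.2 (hw0 x₀).le
  have hr0 : 0 ≤ 1 - (w x₀)⁻¹ := sub_nonneg.2 (inv_le_one_of_one_le₀ hW)
  set π : Measure Ω := q.withDensity fun y => ENNReal.ofReal (w y) with hπ
  have hDc : MeasurableSet (Set.diagonal Ω)ᶜ := (measurableSet_diagonal (α := Ω)).compl
  have hhold := iterate_bind_crnPair_stationaryCold_offDiagonal_eq hw hw0 hmax hqx Khat hK n
  -- the `r` part: started on the diagonal, never separates
  have hdiag : ((fun m : Measure (Ω × Ω) => m.bind Khat)^[n] (Measure.dirac (x₀, x₀))) (Set.diagonal Ω)ᶜ = 0 :=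
    iterate_bind_crnPair_offDiagonal_eq_zero_of_diag hw hw0 Khat hK n _
      (by rw [Measure.dirac_apply' _ hDc, Set.indicator_of_notMem (fun h => Set.notMem_of_mem_compl h (Set.mem_diagonal x₀))])
  rw [coldLag_eq_mixture hw0 hmax, iterate_bind_add Khat n, iterate_bind_smul_measure, iterate_bind_smul_measure, Measure.real,
    Measure.add_apply, Measure.smul_apply, Measure.smul_apply, smul_eq_mul, smul_eq_mul, hdiag, mul_zero, add_zero,
    ENNReal.toReal_mul, ENNReal.toReal_ofReal hWinv0, ← Measure.real, hhold]

/-- **`Σ_{n≥0} P(X_{b+n} ≠ X′_{b+n}) = r^b` EXACTLY** from the cold lag-one coupling (no atom at `x₀`): `(1/W)·Σ_{n≥0} r^{b+n} = r^b` because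
`1 − r = 1/W`. [ours] -/
theorem crn_coldLag_hasSum_offDiagonal [MeasurableSingletonClass Ω] [MeasurableEq Ω] [Fact (Measurable w)] (hw0 : ∀ y, 0 < w y)
    {x₀ : Ω} (hmax : ∀ y, w y ≤ w x₀) (hqx : q {x₀} = 0) [IsProbabilityMeasure (q.withDensity fun y => ENNReal.ofReal (w y))]
    (Khat : Kernel (Ω × Ω) (Ω × Ω)) [IsMarkovKernel Khat]
    (hK : ∀ z : Ω × Ω, Khat z = (q.prod (volume : Measure unitInterval)).map (fun p : Ω × unitInterval =>
      ((if (p.2 : ℝ) * w z.1 ≤ w p.1 then p.1 else z.1), (if (p.2 : ℝ) * w z.2 ≤ w p.1 then p.1 else z.2)))) (b : ℕ) :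
    HasSum (fun n => ((fun m : Measure (Ω × Ω) => m.bind Khat)^[b + n] ((indepMH q w x₀).prod (Measure.dirac x₀))).real (Set.diagonal Ω)ᶜ)
      ((1 - (w x₀)⁻¹) ^ b) := by
  have hW : 1 ≤ w x₀ := one_le_of_mode (q := q) hmax
  have hWpos : 0 < w x₀ := hw0 x₀
  have hr0 : 0 ≤ 1 - (w x₀)⁻¹ := sub_nonneg.2 (inv_le_one_of_one_le₀ hW)
  have hr1 : 1 - (w x₀)⁻¹ < 1 := sub_lt_self _ (inv_pos.2 hWpos)
  have hfun : (fun n => ((fun m : Measure (Ω × Ω) => m.bind Khat)^[b + n] ((indepMH q w x₀).prod (Measure.dirac x₀))).real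
      (Set.diagonal Ω)ᶜ) = fun n => (w x₀)⁻¹ * (1 - (w x₀)⁻¹) ^ b * (1 - (w x₀)⁻¹) ^ n := by
    funext n; rw [iterate_bind_crnPair_coldLag_offDiagonal_eq hw0 hmax hqx Khat hK (b + n), pow_add, mul_assoc]
  rw [hfun]
  have h := (hasSum_geometric_of_lt_one hr0 hr1).mul_left ((w x₀)⁻¹ * (1 - (w x₀)⁻¹) ^ b)
  rwa [sub_sub_cancel, inv_inv, mul_assoc, mul_comm ((1 - (w x₀)⁻¹) ^ b), ← mul_assoc, inv_mul_cancel₀ hWpos.ne', one_mul] at h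

/-- `tsum` form: `Σ_{n≥0} P(X_{b+n} ≠ X′_{b+n}) = r^b`. [ours] -/
theorem crn_coldLag_tsum_offDiagonal_eq [MeasurableSingletonClass Ω] [MeasurableEq Ω] [Fact (Measurable w)] (hw0 : ∀ y, 0 < w y)
    {x₀ : Ω} (hmax : ∀ y, w y ≤ w x₀) (hqx : q {x₀} = 0) [IsProbabilityMeasure (q.withDensity fun y => ENNReal.ofReal (w y))]
    (Khat : Kernel (Ω × Ω) (Ω × Ω)) [IsMarkovKernel Khat]
    (hK : ∀ z : Ω × Ω, Khat z = (q.prod (volume : Measure unitInterval)).map (fun p : Ω × unitInterval =>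
      ((if (p.2 : ℝ) * w z.1 ≤ w p.1 then p.1 else z.1), (if (p.2 : ℝ) * w z.2 ≤ w p.1 then p.1 else z.2)))) (b : ℕ) :
    ∑' n, ((fun m : Measure (Ω × Ω) => m.bind Khat)^[b + n] ((indepMH q w x₀).prod (Measure.dirac x₀))).real (Set.diagonal Ω)ᶜ =
      (1 - (w x₀)⁻¹) ^ b :=
  (crn_coldLag_hasSum_offDiagonal hw0 hmax hqx Khat hK b).tsum_eq

/-! ## §3 The diagnostic is attained -/

/-- **A pair chain whose second coordinate starts at `x₀` carries the cold run**: `P(Y_b ∈ S) = δ_{x₀}K^b(S)` for every initial coupling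
`μ̂₀` with `μ̂₀∘snd⁻¹ = δ_{x₀}` (set-wise). [ours, transfer] -/
theorem crn_coldSnd_measureReal_snd_eq [Fact (Measurable w)] (hw0 : ∀ y, 0 < w y) {x₀ : Ω}
    (Khat : Kernel (Ω × Ω) (Ω × Ω)) [IsMarkovKernel Khat]
    (hK : ∀ z : Ω × Ω, Khat z = (q.prod (volume : Measure unitInterval)).map (fun p : Ω × unitInterval =>
      ((if (p.2 : ℝ) * w z.1 ≤ w p.1 then p.1 else z.1), (if (p.2 : ℝ) * w z.2 ≤ w p.1 then p.1 else z.2))))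
    (μ₀ : Measure (Ω × Ω)) [IsProbabilityMeasure μ₀] (hsnd : μ₀.map Prod.snd = Measure.dirac x₀)
    {S : Set Ω} (hS : MeasurableSet S) (b : ℕ) :
    (Kernel.trajMeasure (X := fun _ : ℕ => Ω × Ω) μ₀
        (fun n : ℕ => Khat.comap (fun h : (i : ↥(Finset.Iic n)) → Ω × Ω => h ⟨n, Finset.mem_Iic.2 le_rfl⟩)
          (measurable_pi_apply _))).real {z | (z b).2 ∈ S} =
      ((fun m : Measure Ω => m.bind (indepMH q w))^[b] (Measure.dirac x₀)).real S := by
  have h := crnLag_integral_snd_eq hw0 Khat hK μ₀ (measurable_one.indicator hS) (C := 1)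
    (fun x => by
      by_cases hx : x ∈ S
      · rw [Set.indicator_of_mem hx, Pi.one_apply, abs_one]
      · rw [Set.indicator_of_notMem hx, abs_zero]; exact zero_le_one) b
  rw [hsnd, integral_indicator_one hS] at h
  have hfun : (fun z : ℕ → Ω × Ω => S.indicator (1 : Ω → ℝ) ((z b).2)) =
      ({z : ℕ → Ω × Ω | (z b).2 ∈ S}).indicator (1 : (ℕ → Ω × Ω) → ℝ) := by
    funext z
    by_cases hz : (z b).2 ∈ S
    · rw [Set.indicator_of_mem hz, Set.indicator_of_mem (show z ∈ {z : ℕ → Ω × Ω | (z b).2 ∈ S} from hz)]; rfl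
    · rw [Set.indicator_of_notMem hz, Set.indicator_of_notMem (show z ∉ {z : ℕ → Ω × Ω | (z b).2 ∈ S} from hz)]
  have hSm : MeasurableSet {z : ℕ → Ω × Ω | (z b).2 ∈ S} := hS.preimage (measurable_snd.comp (measurable_pi_apply b))
  rw [hfun, integral_indicator_one hSm] at h
  exact h

/-- **THE DIAGNOSTIC IS ATTAINED.**  Cold lag-one coupling, proposal without an atom at `x₀`; on the event "the run has left the mode",
`S = {x₀}ᶜ`: `|π(S) − P(Y_b ∈ S)| = r^b = Σ_{n≥0} P(X_{b+n} ≠ X′_{b+n})` — the inequality of `…TotalVariationDiagnostic` holds with EQUALITY. [ours] -/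
theorem crn_coldLag_diagnostic_attained [MeasurableSingletonClass Ω] [MeasurableEq Ω] [Fact (Measurable w)] (hw0 : ∀ y, 0 < w y)
    {x₀ : Ω} (hmax : ∀ y, w y ≤ w x₀) (hqx : q {x₀} = 0) [IsProbabilityMeasure (q.withDensity fun y => ENNReal.ofReal (w y))]
    (Khat : Kernel (Ω × Ω) (Ω × Ω)) [IsMarkovKernel Khat]
    (hK : ∀ z : Ω × Ω, Khat z = (q.prod (volume : Measure unitInterval)).map (fun p : Ω × unitInterval =>
      ((if (p.2 : ℝ) * w z.1 ≤ w p.1 then p.1 else z.1), (if (p.2 : ℝ) * w z.2 ≤ w p.1 then p.1 else z.2)))) (b : ℕ) :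
    |(q.withDensity fun y => ENNReal.ofReal (w y)).real {x₀}ᶜ -
        (Kernel.trajMeasure (X := fun _ : ℕ => Ω × Ω) ((indepMH q w x₀).prod (Measure.dirac x₀))
          (fun n : ℕ => Khat.comap (fun h : (i : ↥(Finset.Iic n)) → Ω × Ω => h ⟨n, Finset.mem_Iic.2 le_rfl⟩)
            (measurable_pi_apply _))).real {z | (z b).2 ∈ ({x₀}ᶜ : Set Ω)}| = (1 - (w x₀)⁻¹) ^ b ∧
    ∑' n, ((fun m : Measure (Ω × Ω) => m.bind Khat)^[b + n] ((indepMH q w x₀).prod (Measure.dirac x₀))).real (Set.diagonal Ω)ᶜ =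
      (1 - (w x₀)⁻¹) ^ b := by
  have hw : Measurable w := Fact.out
  refine ⟨?_, crn_coldLag_tsum_offDiagonal_eq hw0 hmax hqx Khat hK b⟩
  rw [crn_coldSnd_measureReal_snd_eq hw0 Khat hK _ (coldLag_map_fst_snd (q := q) (w := w) x₀).2 (measurableSet_singleton x₀).compl b,
    abs_sub_comm]
  exact iterate_bind_indepMH_dirac_mode_abs_eq_compl_of_null hw hw0 hmax hqx b

/-- **… AND IT IS THE TOTAL VARIATION**: for every measurable `S`, `|π(S) − P(Y_b ∈ S)| ≤ r^b = Σ_{n≥0} P(X_{b+n} ≠ X′_{b+n})`, with equality at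
`S = {x₀}ᶜ` — what the coupled runs report is exactly the worst-case remaining bias of the cold run over all events. [ours] -/
theorem crn_coldLag_diagnostic_eq_totalVariation [MeasurableSingletonClass Ω] [MeasurableEq Ω] [Fact (Measurable w)] (hw0 : ∀ y, 0 < w y)
    {x₀ : Ω} (hmax : ∀ y, w y ≤ w x₀) (hqx : q {x₀} = 0) [IsProbabilityMeasure (q.withDensity fun y => ENNReal.ofReal (w y))]
    (Khat : Kernel (Ω × Ω) (Ω × Ω)) [IsMarkovKernel Khat]
    (hK : ∀ z : Ω × Ω, Khat z = (q.prod (volume : Measure unitInterval)).map (fun p : Ω × unitInterval =>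
      ((if (p.2 : ℝ) * w z.1 ≤ w p.1 then p.1 else z.1), (if (p.2 : ℝ) * w z.2 ≤ w p.1 then p.1 else z.2)))) (b : ℕ) :
    (∀ S : Set Ω, MeasurableSet S →
      |(q.withDensity fun y => ENNReal.ofReal (w y)).real S -
          (Kernel.trajMeasure (X := fun _ : ℕ => Ω × Ω) ((indepMH q w x₀).prod (Measure.dirac x₀))
            (fun n : ℕ => Khat.comap (fun h : (i : ↥(Finset.Iic n)) → Ω × Ω => h ⟨n, Finset.mem_Iic.2 le_rfl⟩)
              (measurable_pi_apply _))).real {z | (z b).2 ∈ S}| ≤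
        ∑' n, ((fun m : Measure (Ω × Ω) => m.bind Khat)^[b + n] ((indepMH q w x₀).prod (Measure.dirac x₀))).real (Set.diagonal Ω)ᶜ) ∧
    |(q.withDensity fun y => ENNReal.ofReal (w y)).real {x₀}ᶜ -
        (Kernel.trajMeasure (X := fun _ : ℕ => Ω × Ω) ((indepMH q w x₀).prod (Measure.dirac x₀))
          (fun n : ℕ => Khat.comap (fun h : (i : ↥(Finset.Iic n)) → Ω × Ω => h ⟨n, Finset.mem_Iic.2 le_rfl⟩)
            (measurable_pi_apply _))).real {z | (z b).2 ∈ ({x₀}ᶜ : Set Ω)}| =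
      ∑' n, ((fun m : Measure (Ω × Ω) => m.bind Khat)^[b + n] ((indepMH q w x₀).prod (Measure.dirac x₀))).real (Set.diagonal Ω)ᶜ := by
  obtain ⟨h1, h2⟩ := crn_coldLag_diagnostic_attained hw0 hmax hqx Khat hK b
  exact ⟨fun S hS => crnLag_measureReal_sub_abs_le_tsum_offDiagonal hw0 hmax Khat hK _ (coldLag_lagOne x₀) hS b, h1.trans h2.symm⟩

/-! ## §4 Every lag `L ≥ 1`: the cold lag-`L` coupling `ν̂_L = K^L(x₀, ·) ⊗ δ_{x₀}` -/

/-- **`K^L(x₀, ·) ⊗ δ_{x₀} = (1 − r^L)·(π ⊗ δ_{x₀}) + r^L·δ_{(x₀,x₀)}`** [from the exact cold-start law `δ_{x₀}K^L = (1 − r^L)π + r^L δ_{x₀}`]. [ours] -/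
theorem coldLagL_eq_mixture [Fact (Measurable w)] (hw0 : ∀ y, 0 < w y) {x₀ : Ω} (hmax : ∀ y, w y ≤ w x₀)
    [IsProbabilityMeasure (q.withDensity fun y => ENNReal.ofReal (w y))] (L : ℕ) :
    ((fun m : Measure Ω => m.bind (indepMH q w))^[L] (Measure.dirac x₀)).prod (Measure.dirac x₀) =
      ENNReal.ofReal (1 - (1 - (w x₀)⁻¹) ^ L) • ((q.withDensity fun y => ENNReal.ofReal (w y)).prod (Measure.dirac x₀)) +
        ENNReal.ofReal ((1 - (w x₀)⁻¹) ^ L) • Measure.dirac (x₀, x₀) := by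
  have hw : Measurable w := Fact.out
  haveI := isProbabilityMeasure_iterate_bind (κ := indepMH q w) (Measure.dirac x₀) L
  rw [Measure.prod_dirac, iterate_bind_indepMH_dirac_mode_eq hw hw0 hmax L, Measure.map_add _ _ measurable_prodMk_right, Measure.map_smul,
    Measure.map_smul, ← Measure.prod_dirac, Measure.map_dirac' measurable_prodMk_right]

/-- The marginals of `ν̂_L` and **the lag-`L` condition** `ν̂_L∘fst⁻¹ = (ν̂_L∘snd⁻¹)K^L`. [ours, bookkeeping] -/
theorem coldLagL_lag [Fact (Measurable w)] (x₀ : Ω) (L : ℕ) :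
    (((fun m : Measure Ω => m.bind (indepMH q w))^[L] (Measure.dirac x₀)).prod (Measure.dirac x₀)).map Prod.snd = Measure.dirac x₀ ∧
    (((fun m : Measure Ω => m.bind (indepMH q w))^[L] (Measure.dirac x₀)).prod (Measure.dirac x₀)).map Prod.fst =
      (fun m : Measure Ω => m.bind (indepMH q w))^[L]
        ((((fun m : Measure Ω => m.bind (indepMH q w))^[L] (Measure.dirac x₀)).prod (Measure.dirac x₀)).map Prod.snd) := by
  haveI := isProbabilityMeasure_iterate_bind (κ := indepMH q w) (Measure.dirac x₀) L
  have h2 : (((fun m : Measure Ω => m.bind (indepMH q w))^[L] (Measure.dirac x₀)).prod (Measure.dirac x₀)).map Prod.snd =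
      Measure.dirac x₀ := by rw [Measure.map_snd_prod, measure_univ, one_smul]
  refine ⟨h2, ?_⟩
  rw [h2, Measure.map_fst_prod, measure_univ, one_smul]

/-- **LAG `L`: `P(X_n ≠ X′_n) = (1 − r^L)·rⁿ` EXACTLY** from the cold lag-`L` coupling (no atom at `x₀`). [ours] -/
theorem iterate_bind_crnPair_coldLagL_offDiagonal_eq [MeasurableSingletonClass Ω] [MeasurableEq Ω] [Fact (Measurable w)]
    (hw0 : ∀ y, 0 < w y) {x₀ : Ω} (hmax : ∀ y, w y ≤ w x₀) (hqx : q {x₀} = 0)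
    [IsProbabilityMeasure (q.withDensity fun y => ENNReal.ofReal (w y))] (Khat : Kernel (Ω × Ω) (Ω × Ω)) [IsMarkovKernel Khat]
    (hK : ∀ z : Ω × Ω, Khat z = (q.prod (volume : Measure unitInterval)).map (fun p : Ω × unitInterval =>
      ((if (p.2 : ℝ) * w z.1 ≤ w p.1 then p.1 else z.1), (if (p.2 : ℝ) * w z.2 ≤ w p.1 then p.1 else z.2)))) (L n : ℕ) :
    ((fun m : Measure (Ω × Ω) => m.bind Khat)^[n]
        (((fun m : Measure Ω => m.bind (indepMH q w))^[L] (Measure.dirac x₀)).prod (Measure.dirac x₀))).real (Set.diagonal Ω)ᶜ =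
      (1 - (1 - (w x₀)⁻¹) ^ L) * (1 - (w x₀)⁻¹) ^ n := by
  have hw : Measurable w := Fact.out
  have hW : 1 ≤ w x₀ := one_le_of_mode (q := q) hmax
  have hWinv0 : 0 ≤ (w x₀)⁻¹ := inv_nonneg.2 (hw0 x₀).le
  have hr0 : 0 ≤ 1 - (w x₀)⁻¹ := sub_nonneg.2 (inv_le_one_of_one_le₀ hW)
  have hr1 : 1 - (w x₀)⁻¹ ≤ 1 := sub_le_self _ hWinv0
  have hc0 : 0 ≤ 1 - (1 - (w x₀)⁻¹) ^ L := sub_nonneg.2 (pow_le_one₀ hr0 hr1)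
  set π : Measure Ω := q.withDensity fun y => ENNReal.ofReal (w y) with hπ
  have hDc : MeasurableSet (Set.diagonal Ω)ᶜ := (measurableSet_diagonal (α := Ω)).compl
  have hhold := iterate_bind_crnPair_stationaryCold_offDiagonal_eq hw hw0 hmax hqx Khat hK n
  have hdiag : ((fun m : Measure (Ω × Ω) => m.bind Khat)^[n] (Measure.dirac (x₀, x₀))) (Set.diagonal Ω)ᶜ = 0 :=
    iterate_bind_crnPair_offDiagonal_eq_zero_of_diag hw hw0 Khat hK n _
      (by rw [Measure.dirac_apply' _ hDc, Set.indicator_of_notMem (fun h => Set.notMem_of_mem_compl h (Set.mem_diagonal x₀))])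
  rw [coldLagL_eq_mixture hw0 hmax L, iterate_bind_add Khat n, iterate_bind_smul_measure, iterate_bind_smul_measure, Measure.real,
    Measure.add_apply, Measure.smul_apply, Measure.smul_apply, smul_eq_mul, smul_eq_mul, hdiag, mul_zero, add_zero,
    ENNReal.toReal_mul, ENNReal.toReal_ofReal hc0, ← Measure.real, hhold]

/-- **LAG `L ≥ 1`: `Σ_{j≥0} P(X_{k+jL} ≠ X′_{k+jL}) = r^k` EXACTLY** from the cold lag-`L` coupling (no atom at `x₀`; `W > 1` or not):
`(1 − r^L)·r^k·Σ_j (r^L)^j = r^k`. [ours] -/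
theorem crn_coldLagL_hasSum_offDiagonal [MeasurableSingletonClass Ω] [MeasurableEq Ω] [Fact (Measurable w)] (hw0 : ∀ y, 0 < w y)
    {x₀ : Ω} (hmax : ∀ y, w y ≤ w x₀) (hqx : q {x₀} = 0) [IsProbabilityMeasure (q.withDensity fun y => ENNReal.ofReal (w y))]
    (Khat : Kernel (Ω × Ω) (Ω × Ω)) [IsMarkovKernel Khat]
    (hK : ∀ z : Ω × Ω, Khat z = (q.prod (volume : Measure unitInterval)).map (fun p : Ω × unitInterval =>
      ((if (p.2 : ℝ) * w z.1 ≤ w p.1 then p.1 else z.1), (if (p.2 : ℝ) * w z.2 ≤ w p.1 then p.1 else z.2)))) {L : ℕ} (hL : 1 ≤ L)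
    (k : ℕ) :
    HasSum (fun j => ((fun m : Measure (Ω × Ω) => m.bind Khat)^[k + j * L]
        (((fun m : Measure Ω => m.bind (indepMH q w))^[L] (Measure.dirac x₀)).prod (Measure.dirac x₀))).real (Set.diagonal Ω)ᶜ)
      ((1 - (w x₀)⁻¹) ^ k) := by
  have hW : 1 ≤ w x₀ := one_le_of_mode (q := q) hmax
  have hWpos : 0 < w x₀ := hw0 x₀
  have hr0 : 0 ≤ 1 - (w x₀)⁻¹ := sub_nonneg.2 (inv_le_one_of_one_le₀ hW)
  have hr1 : 1 - (w x₀)⁻¹ < 1 := sub_lt_self _ (inv_pos.2 hWpos)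
  have hrL0 : 0 ≤ (1 - (w x₀)⁻¹) ^ L := pow_nonneg hr0 L
  have hrL1 : (1 - (w x₀)⁻¹) ^ L < 1 := pow_lt_one₀ hr0 hr1 (by omega)
  have hne : 1 - (1 - (w x₀)⁻¹) ^ L ≠ 0 := (sub_pos.2 hrL1).ne'
  have hfun : (fun j => ((fun m : Measure (Ω × Ω) => m.bind Khat)^[k + j * L]
      (((fun m : Measure Ω => m.bind (indepMH q w))^[L] (Measure.dirac x₀)).prod (Measure.dirac x₀))).real (Set.diagonal Ω)ᶜ) =
      fun j => (1 - (1 - (w x₀)⁻¹) ^ L) * (1 - (w x₀)⁻¹) ^ k * ((1 - (w x₀)⁻¹) ^ L) ^ j := by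
    funext j; rw [iterate_bind_crnPair_coldLagL_offDiagonal_eq hw0 hmax hqx Khat hK L (k + j * L), pow_add, pow_mul', mul_assoc]
  rw [hfun]
  have h := (hasSum_geometric_of_lt_one hrL0 hrL1).mul_left ((1 - (1 - (w x₀)⁻¹) ^ L) * (1 - (w x₀)⁻¹) ^ k)
  rwa [mul_assoc, mul_comm ((1 - (w x₀)⁻¹) ^ k), ← mul_assoc, mul_inv_cancel₀ hne, one_mul] at h

/-- **LAG `L ≥ 1`: THE DIAGNOSTIC IS ATTAINED** — for every measurable `S`, `|π(S) − P(Y_k ∈ S)| ≤ Σ_{j≥0} P(X_{k+jL} ≠ X′_{k+jL}) = r^k`, with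
equality at `S = {x₀}ᶜ` (cold lag-`L` coupling, no atom at `x₀`). [ours] -/
theorem crn_coldLagL_diagnostic_eq_totalVariation [MeasurableSingletonClass Ω] [MeasurableEq Ω] [Fact (Measurable w)] (hw0 : ∀ y, 0 < w y)
    {x₀ : Ω} (hmax : ∀ y, w y ≤ w x₀) (hqx : q {x₀} = 0) [IsProbabilityMeasure (q.withDensity fun y => ENNReal.ofReal (w y))]
    (Khat : Kernel (Ω × Ω) (Ω × Ω)) [IsMarkovKernel Khat]
    (hK : ∀ z : Ω × Ω, Khat z = (q.prod (volume : Measure unitInterval)).map (fun p : Ω × unitInterval =>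
      ((if (p.2 : ℝ) * w z.1 ≤ w p.1 then p.1 else z.1), (if (p.2 : ℝ) * w z.2 ≤ w p.1 then p.1 else z.2)))) {L : ℕ} (hL : 1 ≤ L)
    (k : ℕ) :
    (∀ S : Set Ω, MeasurableSet S →
      |(q.withDensity fun y => ENNReal.ofReal (w y)).real S -
          (Kernel.trajMeasure (X := fun _ : ℕ => Ω × Ω)
            (((fun m : Measure Ω => m.bind (indepMH q w))^[L] (Measure.dirac x₀)).prod (Measure.dirac x₀))
            (fun n : ℕ => Khat.comap (fun h : (i : ↥(Finset.Iic n)) → Ω × Ω => h ⟨n, Finset.mem_Iic.2 le_rfl⟩)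
              (measurable_pi_apply _))).real {z | (z k).2 ∈ S}| ≤
        ∑' j, ((fun m : Measure (Ω × Ω) => m.bind Khat)^[k + j * L]
          (((fun m : Measure Ω => m.bind (indepMH q w))^[L] (Measure.dirac x₀)).prod (Measure.dirac x₀))).real (Set.diagonal Ω)ᶜ) ∧
    |(q.withDensity fun y => ENNReal.ofReal (w y)).real {x₀}ᶜ -
        (Kernel.trajMeasure (X := fun _ : ℕ => Ω × Ω)
          (((fun m : Measure Ω => m.bind (indepMH q w))^[L] (Measure.dirac x₀)).prod (Measure.dirac x₀))
          (fun n : ℕ => Khat.comap (fun h : (i : ↥(Finset.Iic n)) → Ω × Ω => h ⟨n, Finset.mem_Iic.2 le_rfl⟩)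
            (measurable_pi_apply _))).real {z | (z k).2 ∈ ({x₀}ᶜ : Set Ω)}| = (1 - (w x₀)⁻¹) ^ k ∧
    ∑' j, ((fun m : Measure (Ω × Ω) => m.bind Khat)^[k + j * L]
        (((fun m : Measure Ω => m.bind (indepMH q w))^[L] (Measure.dirac x₀)).prod (Measure.dirac x₀))).real (Set.diagonal Ω)ᶜ =
      (1 - (w x₀)⁻¹) ^ k := by
  have hw : Measurable w := Fact.out
  haveI := isProbabilityMeasure_iterate_bind (κ := indepMH q w) (Measure.dirac x₀) L
  obtain ⟨hsnd, hlag⟩ := coldLagL_lag (q := q) (w := w) x₀ L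
  refine ⟨fun S hS => crnLagL_measureReal_sub_abs_le_tsum_offDiagonal hw0 hmax Khat hK _ hL hlag hS k, ?_,
    (crn_coldLagL_hasSum_offDiagonal hw0 hmax hqx Khat hK hL k).tsum_eq⟩
  rw [crn_coldSnd_measureReal_snd_eq hw0 Khat hK _ hsnd (measurableSet_singleton x₀).compl k, abs_sub_comm]
  exact iterate_bind_indepMH_dirac_mode_abs_eq_compl_of_null hw hw0 hmax hqx k

end Summit.Ventures.LatticeQCDFlow.Exactness

end
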